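import Mathlib
import Literature.AlgebraicGeometry.Resolution.WeightedQuasiRegular
import HarnessLib

/-!
# Weighted quasi-regularity for arbitrary positive integer weights

Topic: `Literature/AlgebraicGeometry/Resolution`. Generalisation of `WeightedQuasiRegular.lean`
(weights `(1, d, d)`) to arbitrary positive integer weights `w = (w₀, w₁, w₂)` on a regular system
of parameters `c = (c₀, c₁, c₂)` of a regular local ring of dimension `3` — the algebraic input
for Hironaka's characteristic POLYHEDRA `Δ(J; u₁, u₂; y)` with two independent boundary
directions (Cossart–Piltant 2008, §4, Lemma 4.5: the monomial valuations `μ₀, μ₁` with weights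
`(1, 1/δ, 1/δ)`, `(1, 1/(δ−1), 0+)`): the weighted order ideals
`F_ρ^{(w)} = (c^e : ⟨w, e⟩ ≥ ρ)` and **weighted quasi-regularity**: a `w`-homogeneous form
`F(Y)` of weight `ρ` with `F(c) ∈ F_{ρ+1}` has all its coefficients in `𝔪`
(`coeff_mem_maximalIdeal_of_weval_mem_general`). Proof as before, through the regular local ring
`S = R[r₀, r₁, r₂]/(r_i^{w_i} − c_i)` (three root adjunctions, `RootAdjunctionRegular`) in which
weighted monomials become honest monomials in the regular system of parameters `(r₀, r₁, r₂)`.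

* `weightedIdealW c w ρ`, `monomial_mem_weightedIdealW`, `weightedIdealW_antitone`,
  `weightedIdealW_mul_le`, `mem_weightedIdealW_iff_exists_mvPolynomial`;
* `exists_rootAdjunction_step`, `exists_rootAdjunction3`;
* `coeff_mem_maximalIdeal_of_weval_mem_general`.

## Sources

* H. Hironaka, *Characteristic polyhedra of singularities*, J. Math. Kyoto Univ. 7 (1967). [Hironaka1967]
* V. Cossart, O. Piltant, J. Algebra 320 (2008), §4, proof of Lemma 4.5 (pp. 12–14). [CossartPiltant2008]
* H. Matsumura, *Commutative Ring Theory* (1986), Thm. 17.10. [Matsumura1987]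
-/

noncomputable section

open IsLocalRing MvPolynomial

namespace Literature.AlgebraicGeometry.Resolution

universe u

variable {R : Type u} [CommRing R]

/-- The monomial `c^e = c₀^{e₀} c₁^{e₁} c₂^{e₂}`. [folklore] -/
def monom3 (c : Fin 3 → R) (e : Fin 3 →₀ ℕ) : R := c 0 ^ e 0 * c 1 ^ e 1 * c 2 ^ e 2

/-- `monom3` is multiplicative in the exponent. [folklore] -/
theorem monom3_add (c : Fin 3 → R) (e e' : Fin 3 →₀ ℕ) :
    monom3 c (e + e') = monom3 c e * monom3 c e' := by
  simp only [monom3, Finsupp.add_apply, pow_add]; ring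

/-- `eval c (monomial e a) = a · c^e`. [folklore] -/
theorem eval_monomial_eq_monom3 (c : Fin 3 → R) (e : Fin 3 →₀ ℕ) (a : R) :
    eval c (monomial e a) = a * monom3 c e := by
  rw [eval_monomial_three]; rfl

/-- **The weighted order ideal** `F_ρ^{(w)} = (c^e : ⟨w, e⟩ ≥ ρ)` for weights `w : Fin 3 → ℕ`.
[cite: Hironaka1967, §1] -/
def weightedIdealW (c : Fin 3 → R) (w : Fin 3 → ℕ) (ρ : ℕ) : Ideal R :=
  Ideal.span {m | ∃ e : Fin 3 →₀ ℕ, ρ ≤ Finsupp.weight w e ∧ m = monom3 c e}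

/-- Monomials of weight `≥ ρ` lie in `F_ρ`. [folklore] -/
theorem monomial_mem_weightedIdealW (c : Fin 3 → R) (w : Fin 3 → ℕ) {ρ : ℕ} {e : Fin 3 →₀ ℕ}
    (h : ρ ≤ Finsupp.weight w e) : monom3 c e ∈ weightedIdealW c w ρ :=
  Ideal.subset_span ⟨e, h, rfl⟩

/-- `F_ρ` decreases with `ρ`. [folklore] -/
theorem weightedIdealW_antitone (c : Fin 3 → R) (w : Fin 3 → ℕ) {ρ σ : ℕ} (h : ρ ≤ σ) :
    weightedIdealW c w σ ≤ weightedIdealW c w ρ := by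
  refine Ideal.span_le.mpr ?_
  rintro _ ⟨e, he, rfl⟩
  exact monomial_mem_weightedIdealW c w (h.trans he)

/-- `F_ρ · F_σ ⊆ F_{ρ+σ}`. [folklore] -/
theorem weightedIdealW_mul_le (c : Fin 3 → R) (w : Fin 3 → ℕ) (ρ σ : ℕ) :
    weightedIdealW c w ρ * weightedIdealW c w σ ≤ weightedIdealW c w (ρ + σ) := by
  rw [weightedIdealW, weightedIdealW, Ideal.span_mul_span']
  refine Ideal.span_le.mpr ?_
  rintro _ ⟨_, ⟨e, he, rfl⟩, _, ⟨e', he', rfl⟩, rfl⟩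
  change monom3 c e * monom3 c e' ∈ _
  rw [← monom3_add]
  refine monomial_mem_weightedIdealW c w ?_
  rw [map_add]
  omega

/-- `𝔪 · F_ρ ⊆ F_{ρ+1}` when all weights are positive and `(c) = 𝔪`. [folklore] -/
theorem maximalIdeal_mul_weightedIdealW_le [IsLocalRing R] (c : Fin 3 → R) (w : Fin 3 → ℕ)
    (hw : ∀ i, 0 < w i) (hgen : Ideal.span (Set.range c) = maximalIdeal R) (ρ : ℕ) :
    maximalIdeal R * weightedIdealW c w ρ ≤ weightedIdealW c w (ρ + 1) := by
  have h1 : maximalIdeal R ≤ weightedIdealW c w 1 := by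
    rw [← hgen, Ideal.span_le]
    rintro _ ⟨i, rfl⟩
    have : c i = monom3 c (Finsupp.single i 1) := by
      fin_cases i <;> simp [monom3]
    rw [SetLike.mem_coe, this]
    refine monomial_mem_weightedIdealW c w ?_
    rw [Finsupp.weight_apply, Finsupp.sum_single_index (by simp)]
    simpa using Nat.one_le_iff_ne_zero.mpr (hw i).ne'
  calc maximalIdeal R * weightedIdealW c w ρ ≤ weightedIdealW c w 1 * weightedIdealW c w ρ :=
        Ideal.mul_mono_left h1
    _ ≤ weightedIdealW c w (1 + ρ) := weightedIdealW_mul_le c w 1 ρ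
    _ = weightedIdealW c w (ρ + 1) := by rw [add_comm]

/-- **`F_ρ = {P(c) : every monomial of `P` has weight ≥ ρ}`.** [folklore] -/
theorem mem_weightedIdealW_iff_exists_mvPolynomial (c : Fin 3 → R) (w : Fin 3 → ℕ) (ρ : ℕ) (f : R) :
    f ∈ weightedIdealW c w ρ ↔ ∃ P : MvPolynomial (Fin 3) R,
      (∀ m ∈ P.support, ρ ≤ Finsupp.weight w m) ∧ eval c P = f := by
  classical
  constructor
  · intro hf
    refine Submodule.span_induction ?_ ?_ ?_ ?_ hf
    · rintro _ ⟨e, he, rfl⟩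
      refine ⟨monomial e 1, ?_, ?_⟩
      · intro m hm
        have hm' := Finset.mem_singleton.mp (support_monomial_subset hm)
        subst hm'; exact he
      · rw [eval_monomial_eq_monom3, one_mul]
    · exact ⟨0, by simp, by simp⟩
    · rintro f g - - ⟨P, hP, rfl⟩ ⟨Q, hQ, rfl⟩
      refine ⟨P + Q, fun m hm => ?_, by rw [map_add]⟩
      rcases Finset.mem_union.mp (support_add hm) with h | h
      · exact hP m h
      · exact hQ m h
    · rintro r f - ⟨P, hP, rfl⟩
      refine ⟨C r * P, fun m hm => ?_, by rw [map_mul, eval_C, smul_eq_mul]⟩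
      have : m ∈ P.support := by
        rw [mem_support_iff] at hm ⊢
        rw [coeff_C_mul] at hm
        exact right_ne_zero_of_mul hm
      exact hP m this
  · rintro ⟨P, hP, rfl⟩
    rw [P.as_sum, map_sum]
    refine Ideal.sum_mem _ fun m hm => ?_
    rw [eval_monomial_eq_monom3]
    exact Ideal.mul_mem_left _ _ (monomial_mem_weightedIdealW c w (hP m hm))

/-! ## Root adjunctions -/

/-- **One root adjunction**: for a regular local `A` of dimension `3` with `𝔪 = (a, b₁, b₂)` and
`d ≥ 1`, there is a regular local `B` of dimension `3`, a local injective `ι : A → B` and `r ∈ B`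
with `r^d = ι a` and `𝔪_B = (r, ι b₁, ι b₂)`. [cite: Matsumura1987, Thm. 14.2] -/
theorem exists_rootAdjunction_step {A : Type u} [CommRing A] [IsRegularLocalRing A] (a b₁ b₂ : A)
    (hgen : Ideal.span {a, b₁, b₂} = maximalIdeal A) (hdim : ringKrullDim A = 3) {d : ℕ}
    (hd : 0 < d) :
    ∃ (B : Type u) (_ : CommRing B) (_ : IsRegularLocalRing B) (ι : A →+* B) (r : B),
      IsLocalHom ι ∧ Function.Injective ι ∧ r ^ d = ι a ∧
      Ideal.span {r, ι b₁, ι b₂} = maximalIdeal B ∧ ringKrullDim B = 3 := by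
  have hgen1 : Ideal.span (insert a (Set.range ![b₁, b₂])) = maximalIdeal A := by
    rw [← hgen]; congr 1; ext x; simp; tauto
  obtain ⟨hloc, hreg, hdim', hmax, hlh, hinj⟩ :=
    AdjoinRoot.isRegularLocalRing_X_pow_sub_C (m := 2) ![b₁, b₂] a hgen1 (by rw [hdim]; rfl) hd
  haveI := hloc
  refine ⟨_, inferInstance, hreg, AdjoinRoot.of _, AdjoinRoot.root _, hlh, hinj, ?_, ?_, ?_⟩
  · have := AdjoinRoot.eval₂_root (Polynomial.X ^ d - Polynomial.C a : Polynomial A)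
    rwa [Polynomial.eval₂_sub, Polynomial.eval₂_X_pow, Polynomial.eval₂_C, sub_eq_zero] at this
  · rw [hmax]; congr 1; ext x
    simp; tauto
  · exact_mod_cast hdim'

/-- **The triple root adjunction** `S = R[r₀, r₁, r₂]/(r_i^{w_i} − c_i)`: regular local of
dimension `3` with regular system of parameters `(r₀, r₁, r₂)`, `r_i^{w_i} = ι c_i`, `ι` local and
injective. [cite: Hironaka1967, §1] [cite: Matsumura1987, Thm. 14.2] -/
theorem exists_rootAdjunction3 [IsRegularLocalRing R] (c : Fin 3 → R)
    (hgen : Ideal.span {c 0, c 1, c 2} = maximalIdeal R) (hdim : ringKrullDim R = 3)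
    (w : Fin 3 → ℕ) (hw : ∀ i, 0 < w i) :
    ∃ (S : Type u) (_ : CommRing S) (_ : IsRegularLocalRing S) (ι : R →+* S) (r : Fin 3 → S),
      IsLocalHom ι ∧ Function.Injective ι ∧ (∀ i, r i ^ w i = ι (c i)) ∧
      Ideal.span {r 0, r 1, r 2} = maximalIdeal S ∧ ringKrullDim S = 3 := by
  -- adjoin a `w₀`-th root of `c₀`
  obtain ⟨B₁, _, _, ι₁, r₀, hl₁, hi₁, hr₀, hm₁, hd₁⟩ :=
    exists_rootAdjunction_step (c 0) (c 1) (c 2) hgen hdim (hw 0)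
  -- adjoin a `w₁`-th root of `c₁`
  have hm₁' : Ideal.span {ι₁ (c 1), ι₁ (c 2), r₀} = maximalIdeal B₁ := by
    rw [← hm₁]; congr 1; ext x; simp only [Set.mem_insert_iff, Set.mem_singleton_iff]; tauto
  obtain ⟨B₂, _, _, ι₂, r₁, hl₂, hi₂, hr₁, hm₂, hd₂⟩ :=
    exists_rootAdjunction_step (ι₁ (c 1)) (ι₁ (c 2)) r₀ hm₁' hd₁ (hw 1)
  -- adjoin a `w₂`-th root of `c₂`
  have hm₂' : Ideal.span {ι₂ (ι₁ (c 2)), ι₂ r₀, r₁} = maximalIdeal B₂ := by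
    rw [← hm₂]; congr 1; ext x; simp only [Set.mem_insert_iff, Set.mem_singleton_iff]; tauto
  obtain ⟨S, _, hregS, ι₃, r₂, hl₃, hi₃, hr₂, hm₃, hd₃⟩ :=
    exists_rootAdjunction_step (ι₂ (ι₁ (c 2))) (ι₂ r₀) r₁ hm₂' hd₂ (hw 2)
  haveI := hl₁; haveI := hl₂; haveI := hl₃
  refine ⟨S, inferInstance, hregS, ι₃.comp (ι₂.comp ι₁), ![ι₃ (ι₂ r₀), ι₃ r₁, r₂],
    RingHom.isLocalHom_comp _ _, hi₃.comp (hi₂.comp hi₁), ?_, ?_, hd₃⟩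
  · intro i
    fin_cases i
    · change (ι₃ (ι₂ r₀)) ^ w 0 = ι₃ (ι₂ (ι₁ (c 0)))
      rw [← map_pow, ← map_pow, hr₀]
    · change (ι₃ r₁) ^ w 1 = ι₃ (ι₂ (ι₁ (c 1)))
      rw [← map_pow, hr₁]
    · exact hr₂
  · rw [← hm₃]; congr 1; ext x
    simp only [Matrix.cons_val_zero, Matrix.cons_val_one, Matrix.head_cons, Matrix.cons_val_two,
      Matrix.tail_cons, Set.mem_insert_iff, Set.mem_singleton_iff]
    tauto

/-! ## Weighted quasi-regularity -/

/-- The exponent map `e ↦ (w₀ e₀, w₁ e₁, w₂ e₂)`. [folklore] -/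
def stretchW (w : Fin 3 → ℕ) (e : Fin 3 →₀ ℕ) : Fin 3 →₀ ℕ :=
  Finsupp.equivFunOnFinite.symm fun i => w i * e i

/-- Components of `stretchW`. [folklore] -/
@[simp] theorem stretchW_apply (w : Fin 3 → ℕ) (e : Fin 3 →₀ ℕ) (i : Fin 3) :
    stretchW w e i = w i * e i := rfl

/-- `stretchW` is injective for positive weights. [folklore] -/
theorem stretchW_injective {w : Fin 3 → ℕ} (hw : ∀ i, 0 < w i) : Function.Injective (stretchW w) := by
  intro e e' h
  ext i
  have := congrArg (fun n : Fin 3 →₀ ℕ => n i) h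
  simp only [stretchW_apply] at this
  exact Nat.eq_of_mul_eq_mul_left (hw i) this

/-- The degree of `stretchW w e` is the weight of `e`. [folklore] -/
theorem degree_stretchW (w : Fin 3 → ℕ) (e : Fin 3 →₀ ℕ) :
    (stretchW w e).degree = Finsupp.weight w e := by
  rw [Finsupp.degree_eq_weight_one]
  change Finsupp.weight (fun _ => 1) (stretchW w e) = _
  rw [Finsupp.weight_apply, Finsupp.weight_apply, Finsupp.sum_fintype _ _ (by simp),
    Finsupp.sum_fintype _ _ (by simp)]
  simp [Fin.sum_univ_three, mul_comm]

/-- **Weighted quasi-regularity for positive integer weights**: if `F ∈ R[Y₀, Y₁, Y₂]` is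
`w`-homogeneous of weight `ρ` and `F(c) ∈ F_{ρ+1}^{(w)}`, then every coefficient of `F` lies in `𝔪`
(Matsumura 17.10 in the triple root adjunction). [cite: Hironaka1967, §1] [cite: Matsumura1987, Thm. 17.10] -/
theorem coeff_mem_maximalIdeal_of_weval_mem_general [IsRegularLocalRing R] (c : Fin 3 → R)
    (hgen : Ideal.span {c 0, c 1, c 2} = maximalIdeal R) (hdim : ringKrullDim R = 3)
    (w : Fin 3 → ℕ) (hw : ∀ i, 0 < w i) {ρ : ℕ} {F : MvPolynomial (Fin 3) R}
    (hF : ∀ m ∈ F.support, Finsupp.weight w m = ρ)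
    (h : eval c F ∈ weightedIdealW c w (ρ + 1)) (m : Fin 3 →₀ ℕ) :
    F.coeff m ∈ maximalIdeal R := by
  classical
  by_cases hm : m ∈ F.support
  swap
  · rw [notMem_support_iff.mp hm]; exact Ideal.zero_mem _
  obtain ⟨S, _, _, ι, r, hιloc, -, hr, hgenS, hdimS⟩ := exists_rootAdjunction3 c hgen hdim w hw
  haveI := hιloc
  -- the stretched form
  set G : MvPolynomial (Fin 3) S := ∑ n ∈ F.support, monomial (stretchW w n) (ι (F.coeff n))
    with hG
  have hGcoeff : ∀ n ∈ F.support, G.coeff (stretchW w n) = ι (F.coeff n) := by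
    intro n hn
    rw [hG, coeff_sum, Finset.sum_eq_single n]
    · rw [coeff_monomial, if_pos rfl]
    · intro n' _ hne
      rw [coeff_monomial, if_neg]
      exact fun h' => hne (stretchW_injective hw h')
    · intro hn'; exact absurd hn hn'
  have hGhom : G.IsHomogeneous ρ := by
    rw [hG]
    refine IsHomogeneous.sum _ _ _ fun n hn => ?_
    refine isHomogeneous_monomial _ ?_
    rw [degree_stretchW, hF n hn]
  -- `G(r) = ι (F(c))`
  have hpow : ∀ i (k : ℕ), r i ^ (w i * k) = ι (c i ^ k) := by
    intro i k; rw [pow_mul, hr i, map_pow]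
  have hGeval : eval r G = ι (eval c F) := by
    conv_rhs => rw [F.as_sum, map_sum, map_sum]
    rw [hG, map_sum]
    refine Finset.sum_congr rfl fun n _ => ?_
    rw [eval_monomial_eq_monom3, eval_monomial_eq_monom3, map_mul]
    congr 1
    simp only [monom3, stretchW_apply, hpow, ← map_mul]
  -- `ι(F_{ρ+1}) ⊆ 𝔫^{ρ+1}`
  have hrm : ∀ i, r i ∈ maximalIdeal S := fun i => by
    rw [← hgenS]; fin_cases i <;> exact Ideal.subset_span (by simp)
  have hFle : (weightedIdealW c w (ρ + 1)).map ι ≤ maximalIdeal S ^ (ρ + 1) := by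
    rw [weightedIdealW, Ideal.map_span]
    refine Ideal.span_le.mpr ?_
    rintro _ ⟨_, ⟨e, he, rfl⟩, rfl⟩
    have : ι (monom3 c e) = r 0 ^ (w 0 * e 0) * r 1 ^ (w 1 * e 1) * r 2 ^ (w 2 * e 2) := by
      simp only [monom3, map_mul, hpow]
    rw [SetLike.mem_coe, this]
    have hmem := Ideal.mul_mem_mul (Ideal.mul_mem_mul (Ideal.pow_mem_pow (hrm 0) (w 0 * e 0))
      (Ideal.pow_mem_pow (hrm 1) (w 1 * e 1))) (Ideal.pow_mem_pow (hrm 2) (w 2 * e 2))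
    rw [← pow_add, ← pow_add] at hmem
    refine Ideal.pow_le_pow_right ?_ hmem
    have hwt : Finsupp.weight w e = w 0 * e 0 + w 1 * e 1 + w 2 * e 2 := by
      rw [Finsupp.weight_apply, Finsupp.sum_fintype _ _ (by simp)]
      simp [Fin.sum_univ_three, mul_comm]
    omega
  have hGmem : eval r G ∈ maximalIdeal S ^ (ρ + 1) := by
    rw [hGeval]; exact hFle (Ideal.mem_map_of_mem _ h)
  -- Matsumura 17.10 in `S`
  have hfr : (maximalIdeal S).spanFinrank = 3 := by
    have := (isRegularLocalRing_iff S).mp inferInstance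
    rw [hdimS] at this
    exact_mod_cast this
  have hxS : Ideal.span (Set.range r) = maximalIdeal S := by
    rw [← hgenS]; congr 1; ext a
    simp only [Set.mem_range, Set.mem_insert_iff, Set.mem_singleton_iff]
    constructor
    · rintro ⟨i, rfl⟩; fin_cases i <;> simp
    · rintro (rfl | rfl | rfl) <;> exact ⟨_, rfl⟩
  have hc := coeff_mem_maximalIdeal_of_eval_mem_pow hfr r hxS hGhom hGmem (stretchW w m)
  rw [hGcoeff m hm] at hc
  by_contra hcm
  have hunit : IsUnit (F.coeff m) := by
    by_contra h'; exact hcm ((IsLocalRing.mem_maximalIdeal _).mpr h')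
  exact (IsLocalRing.mem_maximalIdeal _).mp hc (hunit.map ι)

end Literature.AlgebraicGeometry.Resolution

end
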